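import Summits.HodgeConjecture.HodgeConjecture.Cruxes.BlochSeedDiscOne.RowAlpha3HonestBudget
import Summits.HodgeConjecture.HodgeConjecture.Cruxes.BlochSeedDiscOne.SeedCheckerSplitBlock
import Literature.AlgebraicGeometry.Modules.LinearOverBase
import Mathlib.Algebra.Homology.DerivedCategory.Ext.Linear

/-!
# `KunnethNoInterference` — the named law for row (8σ), the geometric budget row, and the DIAGONAL LEMMA (hsemireg-semihom-1 g67)

line stmt-HodgeConjecture-18881 Cruxes/BlochSeedDiscOne/Lines/birth.lean 814a6a70c14e831a stub_rung_pad4_seedAt — stub UNTOUCHED, never restated.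
Director R19.847 (2) ∕ R19.853: «v42 row 8 = (8♮) `BudgetClause phiAll 0` (certificate-free) ∕ (8σ) `BudgetClause sigmaH 0` GIVEN the named law
`KunnethNoInterference` (typed Prop over δ₀, C-free: the (D4) condition on the Künneth images ∕ canonical lift) — exactly as door Z carries
`TopChernFourLocalisation`».  THIS FILE TYPES THAT LAW, C-free, over the pair (letter design `D'`, presented sheaf `𝓔`), plus the geometric
budget row it serves and the kernel conversions; and it records (PEN, module ∕ decl docstrings) the DIAGONAL LEMMA that sharpens g66's honest floors.
Imports: `RowAlpha3HonestBudget` (g66: `phiSep`, `phiAll`, caps, B136 digits), `SeedCheckerSplitBlock` (v41: `SplitBlockCore`, for the one-line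
corollary §7), `Modules/LinearOverBase` + Mathlib `Ext.Linear` (the `ℂ`-module structure on `Ext`).  0 `sorry`; no `axiom` ∕ `instance` ∕
`notation` ∕ `unsafe` ∕ `native_decide`; digits by `decide +kernel` as in `SigmaH` §3.  NOTHING here is proved toward HC ∕ HC_CM ∕ HC_AV ∕ №4 ∕
26512 ∕ 18881 ∕ 30548 ∕ H2; letters ≠ sheaves ≠ SEED; a typed law is a HYPOTHESIS, not a theorem; `RuleD`, `HallUp`, `BudgetClause`, `SPlus`,
`sigmaH`, `phiSep`, `phiAll` are untouched (new functionals are added beside them, never in place).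

## §A The currency and the law (what (D4) has to deliver, and no more)
`ext2 𝓔 := Module.finrank ℂ (Ext²_{𝒪_X}(𝓔, 𝓔))` on the pad-4 anchor `X = S⁴` (Mathlib `Abelian.Ext` in `X.Modules`, `HasExt` from the tree's
`Modules.hasExt = HasExt.standard`; `ℂ`-linear via `Modules.instLinearOverBase`; `finrank` of an infinite-dimensional space is `0` — irrelevant for
coherent `𝓔` on the proper `X`).  The budget clause of record `BudgetClause σ π D' : σ D' + 28·(r − 4) + π ≤ 3 136` is a CONSEQUENCE of the
geometric row `ExtBudgetRow π D' 𝓔 : ext2 𝓔 + 28·(r − 4) + π ≤ 3 136` (what Bloch-semiregularity of the seed gives through the frame sequence,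
g66 THEOREM A′ ∕ C, PEN) exactly when `σ D' ≤ ext2 𝓔` (`budgetClause_of_floor`).  For `σ = sigmaH` — the E₁ TOTAL in total degree 2 of the
presentation spectral sequence `E₁^{p,q} = H^q(X, Hom^p(K,K)) ⇒ Ext^{p+q}(𝓔,𝓔)`, `K = [𝓟 → 𝓝] ≃ 𝓔`, columns `p ∈ {−1,0,1}`, counted in the
SEPARATED currency — that inequality IS the law:
  **`KunnethNoInterference D' 𝓔 : sigmaH D' ≤ ext2 𝓔`**.
In a separated realisation (`ext2 ≤ sigmaH` is then the E₁ ceiling) it says `E₁ = E_∞` in total degree 2: no differential `d₁` (cup ∕ composition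
with `φ`, Künneth-multidegree preserving) or `d₂` (the Massey-type `φ∘(·)∘φ`) touching total degree 2 has positive rank — the «(D4) condition on the
Künneth images ∕ canonical lift» of `DMASSN-NECESSITY-dual-g19.md` §1 (D4) (the images `ξ̄_δ ⊗ V_j` … are the images of exactly these cup-product maps
in `H^{0,2} = ⊕ V_g ⊗ V_j`).  In a labelled ∕ legged realisation the same inequality asks that the labelled E_∞ total dominate the separated E₁
count.  Then (8σ) factorises as the director asked: `KunnethNoInterference D' 𝓔 → ExtBudgetRow π D' 𝓔 → BudgetClause sigmaH π D'`
(`budgetClause_sigmaH_of_kni`; v41 corollary `budgetClause_sigmaH_of_kni_core` with `D' = δ.Dsh.shadow`, `𝓔 = δ.S.X₃`).  The law is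
stated PER DATUM (as door Z's localisation law is consumed per certificate); the global form `∀ D' 𝓔, …` is false (take `𝓔` unrelated to `D'`) and
is not offered.

## §B DIAGONAL LEMMA Δ (PEN; new in g67 — sharpens g66 LEMMA M, corrects g66 §5(3))
Setting of g66 THEOREM A′: `0 → 𝓟 → 𝓝 → 𝓔 → 0`, `𝓟 = ⊕ L_p δ_c`, `𝓝 = ⊕ L_ν δ_c` (cells with multiplicities = `D'`, any Pic⁰ decoration `δ`), `φ`
injective.  Call a block `Hom(L_p δ, L_ν δ')` DEGENERATE if some factor of `ν − p` has `n = 0` (zero or null class), and Δ-TYPE a block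
`Hom(L_ν δ_c, L_ν δ_{c'})` of two copies of the same cell with EQUAL decoration (`= 𝒪_X`; `28 = h²(𝒪_X)` classes `θ ⊗ E_{c→c'}` in `E₁^{0,2}`).
(Δ1) `d₁(θ ⊗ E_{c→c'}) = ± θ ∪ (φ-entries)` lands in blocks that are the SAME line bundles as the live entries' blocks (equal decorations); a live
entry with factorwise non-degenerate class has `H^{>0} = 0` (index theorem + Künneth: `H⁰ ≠ 0` forces index `0` on every factor), so Δ-type
classes are `d₁`-closed modulo `H²` of DEGENERATE `P→N` blocks: `rank(d₁|_Δ) ≤ degPN₂ := extPNcap D' 2 − extPN D' 2` (cap − separated value =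
the degenerate blocks' cap, since non-degenerate blocks have cap = value and degenerate ones have value `0`).
(Δ2) A Δ-type block is HIT by `d₁` from `E₁^{−1,2} = H²(Hom(𝓝,𝓟))` only through `a ∈ H²(M⁻¹)` composed with a live entry in `H⁰(M)`; for `M`
non-degenerate live, `M⁻¹` has index `2` on every factor, `H^{<8}(M⁻¹) = 0`; so only DEGENERATE `N→P` blocks hit: `≤ degNP₂ := extNPcap D' 2 −
extNP D' 2`.  Blocks being direct summands, `dim E₂^{0,2} ≥ #Δ − degPN₂ − degNP₂`, and `E₂^{0,2} = E_∞^{0,2}` (three columns).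
(Δ3) The same index argument at the other two spots: only CROSS-type `(0,1)` sources (different cells; same cell with different decoration is a
non-zero Pic⁰ class, no cohomology) reach the non-degenerate part `extPN D' 1` of `E₁^{1,1}`; Δ-type `(0,3)` targets are unreachable from the
non-degenerate part `extNP D' 3` of `E₁^{−1,3}`.  With `#Δ = 28·Σ_cells Σ_{decoration classes} m_κ² ≥ 28·copies`:
  **`ext2 𝓔 ≥ phiAllPlus D'`** for EVERY decoration (`PhiAllPlusFloor`, pen), **`ext2 𝓔 ≥ phiSepPlus D'`** in the separated currency
  (`PhiSepPlusFloor`, pen; there degenerate blocks are dead, `#Δ = 28·copies` survives entirely and the cross `(0,2)` classes add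
  `(extNN 2 + extPP 2 − extPN 2 − extNP 2)⁺`).  Kernel: `phiSep ≤ phiSepPlus ≤ sigmaH`, `0 ≤ phiAllPlus`.
CONSEQUENCES.  (a) LEMMA NI (decidable no-interference test): the six separated vanishings `SepNoInterferenceRows D'` (`extNP 2 = extNP 3 = extNN 1 =
extNN 2 = extPP 1 = extPP 2 = 0`) give `phiSepPlus D' = sigmaH D'` (`phiSepPlus_eq_sigmaH_of_sep`, kernel) — floor = ceiling, so in a SEPARATED
realisation the law HOLDS (`kni_of_phiSepPlusFloor`): B136 ✓ (`sepNoInterferenceRows_B136`, `phiSepPlus_B136 = 16 096 = sigmaH B136`; g66's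
`phiSep B136 = 11 200` is superseded as the sharp separated value — the (0,2) diagonal is NOT killed by `h²(Hom(𝓟,𝓝)) = 55 296`: those blocks are
non-degenerate, `d₁` vanishes on the diagonal).  (b) CORRECTION of g66 §5(3) «the copies cap does not survive honestly»: it survives up to the
degenerate pools — `BudgetClause phiAllPlus 0 D'` with `degPN₂ = degNP₂ = 0` gives `copies + r ≤ 116` DECORATION-FREE
(`copies_add_rank_le_116_of_phiAllPlus`); B136 has no degenerate `P–N` block in degree 2 (`extPNcap B136 2 = extPN B136 2`, `extNPcap B136 2 = 0`), so
`phiAllPlus B136 = 3 808` and **B136 is excluded in EVERY currency**: `3 808 + 112 = 3 920 > 3 136` (`not_budgetClause_phiAllPlus_B136`,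
`not_extBudgetRow_B136`) — g66's `budgetClause_phiAll_B136` («Φ_all(B136) = 0, no decoration-free kill») was the crude floor, not a property of B136.
(c) THE LEGGED ROOM (of record since R19.853: every μ-charged Rule-D design has a leg = a live NULL arrow) is exactly where Δ is silent: legs are
degenerate blocks, the pools `degPN₂ ∕ degNP₂` are large (LINE-14 ∕ B6c designs of record: `130 112 … 599 072` against `#Δ ≤ 41 104`), `phiAllPlus = 0`,
and whether the diagonal survives is decided by the actual ranks of the cup products on the legs — the (D4) dictionary proper (dual g19 §1, c4-1's
block-support rows Σ-K ∕ Σ-DIAG).  There `KunnethNoInterference` is a genuine hypothesis of (8σ) and may FAIL; (8♮) with `phiAllPlus` is what is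
certificate-free, and shell-by-shell it certifies `r ≤ 116` only (`RowAlpha3.rank_le_116_of_honest`).  SEP-vacuity (standing caveat): on the null-arrow
designs the separated currency has no live arrow at all (`extPN D' 0 = 0`), so there (GEN) fails and the separated rows price nothing.

## §C Numerics (hub-local, `code/g67/kni_floor.py` on top of g66's `alpha3_floor.py`; stdlib, exact, < 1 s per design)
B136 (h = 9 and the up-shift h = 14): SEP `3 808 + 12 288 + 0 = 16 096 = sigmaH` (law discharged); ALL `3 808 + 0 + 0` (cross `(0,1)` cap `40 960`
swallows the `(1,1)` piece), `+112 ⇒ KILL`; undecorated labels `32 256`.  The ten LINE-14 ∕ B6c designs of record (a1a8405d, 5050551f, 98386e74,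
64b6d3fe, 4545dca3, a009d00f, 6b7d85b2, c224cb48, 985ff5f9, aa73ca14): separated cross terms all `0` (six vanishings ✓ vacuously, `sigmaH = 28·copies`,
no live separated arrow); ALL ∕ LAB pools `degPN₂ ∈ {130 112, 153 920, 239 936, 268 608, 599 072}` (caps) dominate `#Δ`, `phiAllPlus = 0`, budget
`28(r−4) ≤ 1 904` passes — alive, as the legged-room analysis predicts.  ×2: every separated digit = tree kernel digit (`SigmaH`, `RowAlpha3` §4 and
§5 below); `cross01(B136) = extNNcap 1 + extPPcap 1 − 8·S2 = 8 704 + 41 472 − 9 216`.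
-/

noncomputable section

set_option linter.dupNamespace false
set_option autoImplicit false

open CategoryTheory AlgebraicGeometry
open Literature.AlgebraicGeometry Literature.AlgebraicGeometry.Motives Literature.AlgebraicGeometry.HodgeTheory

namespace Summit.HodgeConjecture.HodgeConjecture.Cruxes.BlochSeedDiscOne.KunnethNoInterference

open Summit.HodgeConjecture.HodgeConjecture.Cruxes.BlochSeedDiscOne.Anchor
open Summit.HodgeConjecture.HodgeConjecture.Cruxes.BlochSeedDiscOne.DepthBoundA4
open Summit.HodgeConjecture.HodgeConjecture.Cruxes.BlochSeedDiscOne.HallB136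
open Summit.HodgeConjecture.HodgeConjecture.Cruxes.BlochSeedDiscOne.RuleDPlate
open Summit.HodgeConjecture.HodgeConjecture.Cruxes.BlochSeedDiscOne.SigmaH
open Summit.HodgeConjecture.HodgeConjecture.Cruxes.BlochSeedDiscOne.RowAlpha3

/-! ## §1 The geometric currency `ext²(𝓔,𝓔)` on the pad-4 anchor -/

section Geometry

variable {E₀ : AbelianVariety ℂ}

/-- `dim_ℂ Ext²_{𝒪_X}(𝓔, 𝓔)` for an `𝒪_X`-module `𝓔` on the pad-4 anchor `X = S⁴` (`Abelian.Ext` in `X.Modules`; `ℂ`-module structure from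
`Modules.instLinearOverBase` + Mathlib `Ext.Linear`; `HasExt` = the tree's `Modules.hasExt`).  `finrank` is `0` off finite dimension. -/
def ext2 (𝓔 : (pad4Anchor E₀).X.left.Modules) : ℕ := Module.finrank ℂ (Abelian.Ext 𝓔 𝓔 2)

/-! ## §2 THE NAMED LAW and the geometric budget row -/

/-- **`KunnethNoInterference` (the named law of row (8σ), director R19.847 (2); a HYPOTHESIS wherever used, C-free, per datum).**  For a letter
design `D'` (intended: the shadow `δ.Dsh.shadow` of a split block's shell design) and a sheaf `𝓔` (intended: the block's cokernel `δ.S.X₃`):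
the separated E₁ count in total degree 2, `sigmaH D' = 28·copies + extPN 1 + extNP 3 + extNN 2 + extPP 2`, is at most `dim Ext²(𝓔,𝓔)`.  In a
separated realisation: `E₁ = E_∞` in total degree 2 of the presentation spectral sequence — no `d₁`∕`d₂` interference between the Künneth blocks
((D4): the Künneth images ∕ canonical lifts meet trivially).  DISCHARGED by LEMMA NI where the six separated vanishings hold (B136); a genuine, possibly
FALSE hypothesis in the legged room (module docstring §B (c)). [law; hsemireg (D4); DMASSN-NECESSITY-dual-g19 §1] -/
def KunnethNoInterference (D' : Design) (𝓔 : (pad4Anchor E₀).X.left.Modules) : Prop :=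
  sigmaH D' ≤ (ext2 𝓔 : ℤ)

/-- **the geometric budget row** (what Bloch-semiregularity of the seed yields through the frame sequence, g66 THEOREM A′ ∕ C — PEN; here a
named `Prop`): `dim Ext²(𝓔,𝓔) + 28·(r − 4) + π ≤ h^{3,5}(X) = 3 136`, `r = D'.rank`, rider `π`. -/
def ExtBudgetRow (π : ℤ) (D' : Design) (𝓔 : (pad4Anchor E₀).X.left.Modules) : Prop :=
  (ext2 𝓔 : ℤ) + 28 * (D'.rank - 4) + π ≤ 3136

variable {D' : Design} {𝓔 : (pad4Anchor E₀).X.left.Modules} {π : ℤ}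

/-- **any floor of `ext²` turns the geometric row into the letter clause of the same shape**: `Φ D' ≤ ext² ⟹ (ExtBudgetRow π ⟹ BudgetClause Φ π)`. -/
theorem budgetClause_of_floor {Φ : Design → ℤ} (hΦ : Φ D' ≤ (ext2 𝓔 : ℤ)) (h : ExtBudgetRow π D' 𝓔) : BudgetClause Φ π D' := by
  unfold ExtBudgetRow at h
  unfold BudgetClause
  omega

/-- **(8σ) GIVEN THE LAW** (director R19.847 (2), the factorisation asked): `KunnethNoInterference ⟹ (ExtBudgetRow π ⟹ BudgetClause sigmaH π)`. -/
theorem budgetClause_sigmaH_of_kni (hk : KunnethNoInterference D' 𝓔) (h : ExtBudgetRow π D' 𝓔) : BudgetClause sigmaH π D' :=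
  budgetClause_of_floor hk h

/-- contrapositive reading: a design failing the letter clause for a floor `Φ ≤ ext²` cannot carry a sheaf satisfying the geometric row. -/
theorem not_extBudgetRow_of_not_budgetClause {Φ : Design → ℤ} (hΦ : Φ D' ≤ (ext2 𝓔 : ℤ)) (hn : ¬ BudgetClause Φ π D') :
    ¬ ExtBudgetRow π D' 𝓔 :=
  fun h => hn (budgetClause_of_floor hΦ h)

/-- the law is monotone in nothing but itself; recorded: a SMALLER functional bounded by `ext²` is implied (`Φ ≤ sigmaH` + law ⟹ `Φ ≤ ext²`). -/
theorem floor_of_kni_of_le {Φ : Design → ℤ} (hle : ∀ D, Φ D ≤ sigmaH D) (hk : KunnethNoInterference D' 𝓔) : Φ D' ≤ (ext2 𝓔 : ℤ) :=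
  le_trans (hle D') hk

end Geometry

/-! ## §3 The refined letter floors of LEMMA Δ (beside g66's `phiSep` ∕ `phiAll`, never in place) -/

/-- cap kernel over ordered entry pairs of ONE side with DIFFERENT cells (cross-type blocks; same-cell pairs are Δ-type or cohomology-free). -/
def crossKer (d : ℕ) (x y : Cell) : ℕ :=
  if x 0 = y 0 ∧ x 1 = y 1 ∧ x 2 = y 2 ∧ x 3 = y 3 then 0 else cellCap d x y

/-- `≥ dim` of the cross-type part of `H^d(End 𝓝)` for every decoration. -/
def crossNNcap (E : Design) (d : ℕ) : ℕ := dsum (crossKer d) E.N E.N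

/-- `≥ dim` of the cross-type part of `H^d(End 𝓟)` for every decoration. -/
def crossPPcap (E : Design) (d : ℕ) : ℕ := dsum (crossKer d) E.P E.P

/-- the DEGENERATE `P→N` pool in degree `d`: cap minus separated value (non-degenerate blocks cancel; degenerate ones have separated value `0`). -/
def degPN (E : Design) (d : ℕ) : ℤ := (extPNcap E d : ℤ) - (extPN E d : ℤ)

/-- the DEGENERATE `N→P` pool in degree `d`. -/
def degNP (E : Design) (d : ℕ) : ℤ := (extNPcap E d : ℤ) - (extNP E d : ℤ)

/-- **Φ⁺_sep** — LEMMA Δ in the SEPARATED currency: the whole diagonal `28·copies` survives, plus the three Morse pieces with only the threats the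
index argument allows: `28·c + (NN2 + PP2 − PN2 − NP2)⁺ + (PN1 − NN1 − PP1 − NP2)⁺ + (NP3 − NN3 − PP3 − PN2)⁺`.  PEN: `Φ⁺_sep(D') ≤ ext²` in every
separated realisation (`PhiSepPlusFloor`). -/
def phiSepPlus (D : Design) : ℤ :=
  28 * (D.copies : ℤ) + pos ((extNN D 2 : ℤ) + (extPP D 2 : ℤ) - (extPN D 2 : ℤ) - (extNP D 2 : ℤ))
  + pos ((extPN D 1 : ℤ) - ((extNN D 1 : ℤ) + (extPP D 1 : ℤ)) - (extNP D 2 : ℤ))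
  + pos ((extNP D 3 : ℤ) - ((extNN D 3 : ℤ) + (extPP D 3 : ℤ)) - (extPN D 2 : ℤ))

/-- **Φ⁺_all** — LEMMA Δ DECORATION-FREE: `(28·c − degPN₂ − degNP₂)⁺ + (PN1 − crossNNcap 1 − crossPPcap 1 − NPcap 2)⁺ + (NP3 − crossNNcap 3 −
crossPPcap 3 − PNcap 2)⁺`.  PEN: `Φ⁺_all(D') ≤ ext²` for EVERY Pic⁰ decoration and every injective `φ` (`PhiAllPlusFloor`). -/
def phiAllPlus (D : Design) : ℤ :=
  pos (28 * (D.copies : ℤ) - degPN D 2 - degNP D 2)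
  + pos ((extPN D 1 : ℤ) - ((crossNNcap D 1 : ℤ) + (crossPPcap D 1 : ℤ)) - (extNPcap D 2 : ℤ))
  + pos ((extNP D 3 : ℤ) - ((crossNNcap D 3 : ℤ) + (crossPPcap D 3 : ℤ)) - (extPNcap D 2 : ℤ))

/-- **LEMMA NI's decidable hypothesis**: the six separated vanishings that empty every source ∕ target touching total degree 2 other than the
diagonal and `extPN 1` (`d₁ : (−1,2)→(0,2)`, `(0,1)→(1,1)`, `(0,2)→(1,2)` cross part, `(−1,3)→(0,3)`; `d₂ : (−1,2)→(1,1)`, `(−1,3)→(1,2)`). -/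
def SepNoInterferenceRows (D : Design) : Prop :=
  extNP D 2 = 0 ∧ extNP D 3 = 0 ∧ extNN D 1 = 0 ∧ extNN D 2 = 0 ∧ extPP D 1 = 0 ∧ extPP D 2 = 0

theorem pos_mono {a b : ℤ} (h : a ≤ b) : pos a ≤ pos b := by
  unfold pos
  exact max_le_max h le_rfl

theorem pos_add_le {a b : ℤ} (ha : 0 ≤ a) : pos (a + b) ≤ a + pos b := by
  unfold pos
  exact max_le (by linarith [le_max_left b 0]) (by linarith [le_max_right b 0])

/-- **g66's floor ≤ the refined floor** (separated currency): `phiSep ≤ phiSepPlus`. -/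
theorem phiSep_le_phiSepPlus (D : Design) : phiSep D ≤ phiSepPlus D := by
  unfold phiSep phiSepPlus
  have h1 : pos (28 * (D.copies : ℤ) + (extNN D 2 : ℤ) + (extPP D 2 : ℤ) - (extPN D 2 : ℤ) - (extNP D 2 : ℤ))
      ≤ 28 * (D.copies : ℤ) + pos ((extNN D 2 : ℤ) + (extPP D 2 : ℤ) - (extPN D 2 : ℤ) - (extNP D 2 : ℤ)) := by
    have := pos_add_le (a := 28 * (D.copies : ℤ)) (b := (extNN D 2 : ℤ) + (extPP D 2 : ℤ) - (extPN D 2 : ℤ) - (extNP D 2 : ℤ)) (by positivity)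
    simpa [add_sub, add_assoc] using this
  have h2 : pos ((extPN D 1 : ℤ) - (8 * (D.copies : ℤ) + (extNN D 1 : ℤ) + (extPP D 1 : ℤ)) - (extNP D 2 : ℤ))
      ≤ pos ((extPN D 1 : ℤ) - ((extNN D 1 : ℤ) + (extPP D 1 : ℤ)) - (extNP D 2 : ℤ)) :=
    pos_mono (by have := (Nat.cast_nonneg (α := ℤ) D.copies); linarith)
  have h3 : pos ((extNP D 3 : ℤ) - (56 * (D.copies : ℤ) + (extNN D 3 : ℤ) + (extPP D 3 : ℤ)) - (extPN D 2 : ℤ))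
      ≤ pos ((extNP D 3 : ℤ) - ((extNN D 3 : ℤ) + (extPP D 3 : ℤ)) - (extPN D 2 : ℤ)) :=
    pos_mono (by have := (Nat.cast_nonneg (α := ℤ) D.copies); linarith)
  linarith

/-- **refined floor ≤ ceiling**: `phiSepPlus ≤ sigmaH` (each piece at most its E₁ term). -/
theorem phiSepPlus_le_sigmaH (D : Design) : phiSepPlus D ≤ sigmaH D := by
  unfold phiSepPlus sigmaH
  have h1 : pos ((extNN D 2 : ℤ) + (extPP D 2 : ℤ) - (extPN D 2 : ℤ) - (extNP D 2 : ℤ)) ≤ (extNN D 2 : ℤ) + (extPP D 2 : ℤ) := by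
    have := pos_sub_le ((extNN D 2 : ℤ) + (extPP D 2 : ℤ)) ((extPN D 2 : ℤ) + (extNP D 2 : ℤ)) (by positivity) (by positivity)
    simpa [sub_sub] using this
  have h2 : pos ((extPN D 1 : ℤ) - ((extNN D 1 : ℤ) + (extPP D 1 : ℤ)) - (extNP D 2 : ℤ)) ≤ (extPN D 1 : ℤ) := by
    have := pos_sub_le (extPN D 1 : ℤ) (((extNN D 1 : ℤ) + (extPP D 1 : ℤ)) + (extNP D 2 : ℤ)) (by positivity) (by positivity)
    simpa [sub_sub] using this
  have h3 : pos ((extNP D 3 : ℤ) - ((extNN D 3 : ℤ) + (extPP D 3 : ℤ)) - (extPN D 2 : ℤ)) ≤ (extNP D 3 : ℤ) := by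
    have := pos_sub_le (extNP D 3 : ℤ) (((extNN D 3 : ℤ) + (extPP D 3 : ℤ)) + (extPN D 2 : ℤ)) (by positivity) (by positivity)
    simpa [sub_sub] using this
  omega

theorem phiAllPlus_nonneg (D : Design) : 0 ≤ phiAllPlus D := by
  unfold phiAllPlus
  have h1 := pos_nonneg (28 * (D.copies : ℤ) - degPN D 2 - degNP D 2)
  have h2 := pos_nonneg ((extPN D 1 : ℤ) - ((crossNNcap D 1 : ℤ) + (crossPPcap D 1 : ℤ)) - (extNPcap D 2 : ℤ))
  have h3 := pos_nonneg ((extNP D 3 : ℤ) - ((crossNNcap D 3 : ℤ) + (crossPPcap D 3 : ℤ)) - (extPNcap D 2 : ℤ))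
  omega

/-- the diagonal piece alone is a floor of `phiAllPlus`. -/
theorem diag_le_phiAllPlus (D : Design) : pos (28 * (D.copies : ℤ) - degPN D 2 - degNP D 2) ≤ phiAllPlus D := by
  unfold phiAllPlus
  have h2 := pos_nonneg ((extPN D 1 : ℤ) - ((crossNNcap D 1 : ℤ) + (crossPPcap D 1 : ℤ)) - (extNPcap D 2 : ℤ))
  have h3 := pos_nonneg ((extNP D 3 : ℤ) - ((crossNNcap D 3 : ℤ) + (crossPPcap D 3 : ℤ)) - (extPNcap D 2 : ℤ))
  omega

/-- **LEMMA NI, kernel half**: under the six separated vanishings the refined separated floor EQUALS the ceiling `sigmaH` — with the pen half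
(`PhiSepPlusFloor`) this discharges `KunnethNoInterference` in separated realisations (`kni_of_phiSepPlusFloor`). -/
theorem phiSepPlus_eq_sigmaH_of_sep {D : Design} (h : SepNoInterferenceRows D) : phiSepPlus D = sigmaH D := by
  obtain ⟨h1, h2, h3, h4, h5, h6⟩ := h
  unfold phiSepPlus sigmaH
  simp only [h1, h2, h3, h4, h5, h6, Nat.cast_zero, pos, max_def]
  split_ifs <;> omega

/-- **the honest copies cap (correction of g66 §5(3))**: with NO degenerate `P–N` pool in degree 2, the decoration-free clause gives
`copies + r ≤ 116 − π/28`; in particular (`π ≥ 0`) `copies + r ≤ 116` — `SigmaH.copies_add_rank_le_of_budget` is then HONEST. -/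
theorem copies_add_rank_le_116_of_phiAllPlus (D : Design) (hPN : degPN D 2 = 0) (hNP : degNP D 2 = 0) (π : ℤ) (hπ : 0 ≤ π)
    (hb : BudgetClause phiAllPlus π D) : (D.copies : ℤ) + D.rank ≤ 116 := by
  unfold BudgetClause at hb
  have hd := diag_le_phiAllPlus D
  rw [hPN, hNP, sub_zero, sub_zero] at hd
  have hp : pos (28 * (D.copies : ℤ)) = 28 * (D.copies : ℤ) := by
    unfold pos
    exact max_eq_left (by positivity)
  rw [hp] at hd
  omega

/-- the refined decoration-free door still caps the rank at `116` (any honest floor is `≥ 0`). -/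
theorem rank_le_116_of_phiAllPlus (π : ℤ) (hπ : 0 ≤ π) (D : Design) (h : BudgetClause phiAllPlus π D) : D.rank ≤ 116 :=
  rank_le_116_of_honest phiAllPlus phiAllPlus_nonneg π hπ D h

/-! ## §4 The pen halves as named laws (hypotheses wherever used) and what they give with the law of §2 -/

section Floors

variable {E₀ : AbelianVariety ℂ}

/-- **LEMMA Δ, separated half (PEN; a hypothesis here)**: in a SEPARATED realisation of `D'` with cokernel `𝓔`, `phiSepPlus D' ≤ dim Ext²(𝓔,𝓔)`. -/
def PhiSepPlusFloor (D' : Design) (𝓔 : (pad4Anchor E₀).X.left.Modules) : Prop :=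
  phiSepPlus D' ≤ (ext2 𝓔 : ℤ)

/-- **LEMMA Δ, decoration-free half (PEN; a hypothesis here)**: in ANY realisation of `D'` (every Pic⁰ decoration, `φ` injective) with cokernel
`𝓔`, `phiAllPlus D' ≤ dim Ext²(𝓔,𝓔)`. -/
def PhiAllPlusFloor (D' : Design) (𝓔 : (pad4Anchor E₀).X.left.Modules) : Prop :=
  phiAllPlus D' ≤ (ext2 𝓔 : ℤ)

variable {D' : Design} {𝓔 : (pad4Anchor E₀).X.left.Modules}

/-- **floor = ceiling discharges the law**: `PhiSepPlusFloor ∧ phiSepPlus D' = sigmaH D' ⟹ KunnethNoInterference`. -/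
theorem kni_of_phiSepPlusFloor (hf : PhiSepPlusFloor D' 𝓔) (he : phiSepPlus D' = sigmaH D') : KunnethNoInterference D' 𝓔 := by
  unfold KunnethNoInterference
  unfold PhiSepPlusFloor at hf
  rw [← he]
  exact hf

/-- … in particular under the six separated vanishings (LEMMA NI). -/
theorem kni_of_phiSepPlusFloor_of_sep (hf : PhiSepPlusFloor D' 𝓔) (hs : SepNoInterferenceRows D') : KunnethNoInterference D' 𝓔 :=
  kni_of_phiSepPlusFloor hf (phiSepPlus_eq_sigmaH_of_sep hs)

/-- (8♮⁺): the decoration-free floor law gives the refined certificate-free clause from the geometric row. -/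
theorem budgetClause_phiAllPlus_of_floor {π : ℤ} (hf : PhiAllPlusFloor D' 𝓔) (h : ExtBudgetRow π D' 𝓔) : BudgetClause phiAllPlus π D' :=
  budgetClause_of_floor hf h

/-- … and g66's (8♮) follows whenever `phiAll ≤ phiAllPlus` on the design (true on every design of record: `phiAll = 0` there). -/
theorem budgetClause_phiAll_of_floor {π : ℤ} (hle : phiAll D' ≤ phiAllPlus D') (hf : PhiAllPlusFloor D' 𝓔) (h : ExtBudgetRow π D' 𝓔) :
    BudgetClause phiAll π D' :=
  budgetClause_of_floor (le_trans hle hf) h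

end Floors

/-! ## §5 B136 digits (kernel) and the verdicts: law discharged (separated); excluded in every currency (decoration-free) -/

theorem sepNoInterferenceRows_B136 : SepNoInterferenceRows B136 :=
  ⟨extNP_B136_two, extNP_B136_three, extNN_B136_one, extNN_B136_two, extPP_B136_one, extPP_B136_two⟩

/-- **floor = ceiling on B136**: `Φ⁺_sep(B136) = 3 808 + 12 288 + 0 = 16 096 = sigmaH B136` (g66's `phiSep B136 = 11 200` was the crude piece). -/
theorem phiSepPlus_B136 : phiSepPlus B136 = 16096 := by
  rw [phiSepPlus_eq_sigmaH_of_sep sepNoInterferenceRows_B136, sigmaH_B136]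

theorem phiSepPlus_B136_eq_sigmaH : phiSepPlus B136 = sigmaH B136 :=
  phiSepPlus_eq_sigmaH_of_sep sepNoInterferenceRows_B136

theorem crossNNcap_B136_one : crossNNcap B136 1 = 0 := by decide +kernel

theorem crossPPcap_B136_one : crossPPcap B136 1 = 40960 := by decide +kernel

theorem crossNNcap_B136_three : crossNNcap B136 3 = 0 := by decide +kernel

theorem crossPPcap_B136_three : crossPPcap B136 3 = 286720 := by decide +kernel

/-- B136 has NO degenerate `P–N` block with `h²`-cap: `extPNcap B136 2 = extPN B136 2 = 55 296`, `extNPcap B136 2 = extNP B136 2 = 0`. -/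
theorem degPN_B136_two : degPN B136 2 = 0 := by
  unfold degPN
  rw [extPNcap_B136_two, extPN_B136_two]
  norm_num

theorem degNP_B136_two : degNP B136 2 = 0 := by
  unfold degNP
  rw [extNPcap_B136_two, extNP_B136_two]
  norm_num

/-- **`Φ⁺_all(B136) = (3 808 − 0 − 0)⁺ + (12 288 − 0 − 40 960 − 0)⁺ + (0 − 0 − 286 720 − 55 296)⁺ = 3 808`**: the diagonal survives every decoration. -/
theorem phiAllPlus_B136 : phiAllPlus B136 = 3808 := by
  unfold phiAllPlus pos
  rw [degPN_B136_two, degNP_B136_two, B136_copies.1, extPN_B136_one, extNP_B136_three, crossNNcap_B136_one, crossPPcap_B136_one,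
    crossNNcap_B136_three, crossPPcap_B136_three, extNPcap_B136_two, extPNcap_B136_two]
  norm_num

/-- on B136 the crude floor is dominated: `phiAll B136 = 0 ≤ 3 808`. -/
theorem phiAll_le_phiAllPlus_B136 : phiAll B136 ≤ phiAllPlus B136 := by
  rw [phiAll_B136, phiAllPlus_B136]
  norm_num

/-- **B136 is excluded DECORATION-FREE**: `3 808 + 28·(8 − 4) + π = 3 920 + π > 3 136` — contrast g66 `budgetClause_phiAll_B136` (crude floor `0`). -/
theorem not_budgetClause_phiAllPlus_B136 (π : ℤ) (hπ : 0 ≤ π) : ¬ BudgetClause phiAllPlus π B136 := by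
  unfold BudgetClause
  rw [phiAllPlus_B136, B136_copies.2.1]
  omega

/-- … and with the trivial frame as well: `3 808 + 28·24 = 4 480 > 3 136`. -/
theorem not_frameBudget_phiAllPlus_B136 : ¬ FrameBudget phiAllPlus B136 := by
  unfold FrameBudget
  rw [phiAllPlus_B136, B136_copies.2.1]
  norm_num

section B136Sheaf

variable {E₀ : AbelianVariety ℂ} {𝓔 : (pad4Anchor E₀).X.left.Modules}

/-- **the law holds on B136 in any separated realisation** (LEMMA NI: pen floor + kernel `floor = ceiling`). -/
theorem kni_B136_of_phiSepPlusFloor (hf : PhiSepPlusFloor B136 𝓔) : KunnethNoInterference B136 𝓔 :=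
  kni_of_phiSepPlusFloor_of_sep hf sepNoInterferenceRows_B136

/-- **no sheaf presented by B136 (any decoration) satisfies the geometric budget row** with `π ≥ 0`, granted the decoration-free floor law. -/
theorem not_extBudgetRow_B136 (hf : PhiAllPlusFloor B136 𝓔) (π : ℤ) (hπ : 0 ≤ π) : ¬ ExtBudgetRow π B136 𝓔 :=
  not_extBudgetRow_of_not_budgetClause hf (not_budgetClause_phiAllPlus_B136 π hπ)

end B136Sheaf

/-! ## §6 Sanity of the new kernels on single cells -/

/-- the cross kernel vanishes on equal cells and is the cap otherwise (hub ↦ hub: `0`; `(2;−4,3)⁴ ↦ (9;0,0)⁴`: `h⁰`-cap `24⁴ = 331 776`). -/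
theorem crossKer_examples :
    crossKer 2 hub4 hub4 = 0 ∧ crossKer 0 (fun _ => (⟨2, -4, 3⟩ : Letter)) hub4 = 331776 := by
  decide +kernel

/-! ## §7 The v41 corollary: (8σ) on a split-block core, given the law (row-local, so it composes with v42's row list unchanged) -/

section SplitBlock

open Summit.HodgeConjecture.HodgeConjecture.Cruxes.BlochSeedDiscOne.SeedChecker
open Summit.HodgeConjecture.HodgeConjecture.Cruxes.BlochSeedDiscOne.SeedChecker.SplitBlock

variable {C : ChernCharacterBetti} {E₀ : AbelianVariety ℂ} {ψ₀ : E₀ ⟶ E₀}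

/-- **(8σ) for a split-block core GIVEN `KunnethNoInterference`** on its (shell shadow, cokernel): the geometric row for `𝓔 = δ.S.X₃` yields the
shadow clause `BudgetClause sigmaH π δ.Dsh.shadow` — the budget conjunct of v41's `ShadowRows sigmaH π` ∕ v42's row 8. -/
theorem budgetClause_sigmaH_of_kni_core (δ : SplitBlockCore C E₀ ψ₀) {π : ℤ}
    (hk : KunnethNoInterference δ.Dsh.shadow δ.S.X₃) (h : ExtBudgetRow π δ.Dsh.shadow δ.S.X₃) :
    BudgetClause sigmaH π δ.Dsh.shadow :=
  budgetClause_sigmaH_of_kni hk h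

/-- **(8♮⁺) for a split-block core, law-free given the decoration-free floor** (LEMMA Δ, pen): `BudgetClause phiAllPlus π δ.Dsh.shadow`. -/
theorem budgetClause_phiAllPlus_of_floor_core (δ : SplitBlockCore C E₀ ψ₀) {π : ℤ}
    (hf : PhiAllPlusFloor δ.Dsh.shadow δ.S.X₃) (h : ExtBudgetRow π δ.Dsh.shadow δ.S.X₃) :
    BudgetClause phiAllPlus π δ.Dsh.shadow :=
  budgetClause_phiAllPlus_of_floor hf h

end SplitBlock

end Summit.HodgeConjecture.HodgeConjecture.Cruxes.BlochSeedDiscOne.KunnethNoInterference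

end
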